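import Literature.MathematicalPhysics.QuantumFieldTheory.Balaban1983to89.B9Eq324DeltaPrimeAZdPer
import Literature.MathematicalPhysics.QuantumFieldTheory.Balaban1983to89.B9Thm31FlatPoincareCoerciveZd

/-!
# `Balaban1983to89.B9Thm31FlatPoincareCoerciveZdPer` — [Balaban1985BackgroundPropagators] Thm 3.1 p. 397 ∕ Thm 3.11 p. 416 AT THE FLAT BACKGROUND ON THE TORUS
# `T_P` READ ON `ℤᵈ`, IN QUANTITATIVE CURRENCY: the UNIFORM COERCIVITY `a₀·⟨f, f⟩_{T_P} ≤ ⟨f, Δ′_a(1) f⟩_{T_P}` on the `P`-periodic site functions, with a constant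
# `a₀ = min{8, a}` depending on the top-level weight only (NOT on `η`, `m`, `P`) — block Poincaré ([Balaban1984PropagatorsII] (2.26)–(2.27)) on the top-level
# blocks, which TILE the period cell; the periodic twin of `B9Thm31FlatPoincareCoerciveZd` (Dirichlet reading at the cube members)

statement-level skeleton of published theorems with citation tags; proofs where landed; nothing here is a claim about the
Yang–Mills mass gap

`[Balaban1985BackgroundPropagators]` ("B9", CMP **99** (1985) 389–434) Thm 3.1 p. 397 (the bounds for `G′ = (Δ′_a)⁻¹` «uniformly in U, Ω_j»; at `U = 1` its input is the
positivity of `Δ′_a`), (3.23)–(3.24) p. 394, Thm 3.11 p. 416 *«Δ′_a, G′ … are positive definite … This is obvious for the first three operators»*.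
`[Balaban1984PropagatorsII]` ("B6", CMP **96** (1984) 223–250) (2.22) p. 226, (2.26)–(2.27) p. 235 (the block inequality).  `[Balaban1985RegularSpaces]` p. 77
*«Ω_j = T_η»*.  PDF held: `paper:balaban1985-cmp99-background-propagators` pp. 394–397, 416.

CITATION HEADER (lean-in-tree rule).  Cell `pub-ymgap` (YM Track A), DAG node N06 = [B9], width seat `pub-ymgap-dag-n06-w4` (g6), the (β′-PERIODIC) road.  WHY: the
companion `B9Eq324DeltaPrimeAZdPer` proves Thm 3.11's first clause on the torus at `U₀ = 1` QUALITATIVELY (kernel trivial ⟹ invertible) and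
`B9Thm311PosDefOpenZdPer` propagates invertibility to a member-dependent NEIGHBOURHOOD of `U₀ = 1`; Thm 3.1's road (decay of `G′`, the Agmon ∕ Combes–Thomas
files of dag-n06-w2 at `ℤᵈ`) and any quantitative small-field class need a COERCIVITY CONSTANT.  THIS FILE gives it at the flat background on `T_P`: the block
inequality (2.27) (this lineage g5's `B9Thm31FlatPoincareCoerciveZd.block227_zd_fnorm`, dag-n05-c's real `block227_zd` underneath) on each top-level block `Bᵐ(y)`,
`y ∈ [0,P∕Lᵐ)ᵈ`, summed over the cell — the top-level blocks tile `[0,P)ᵈ` exactly when `Lᵐ ∣ P` (`B9Eq321LandauOrthogonalZdPer.box_mul_eq_biUnion_blockSites`),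
so NO Dirichlet boundary and no coverage hypothesis beyond «every top-level cell site is a constraint site» (the torus members' `torusLam`).  Nothing is re-declared.

WHAT IS PROVED (kernel, 0 sorry; theorems only — no `def`, no `instance`, no `notation`).
* §1 ★ `block_coercive_one_fun` (THE WEIGHTED BLOCK INEQUALITY AT THE FLAT BACKGROUND for ANY site function `F : ℤᵈ → 𝔸` — g5's `block_coercive_one` without the
  support wrapper: `η·Lʲ ≤ 1`, `a_j ≥ 0`, `a₀ ≤ 8`, `a₀·(Lʲ)^d ≤ a_j·η²·(Lʲ)²` ⟹
  `a₀·Σ_{x∈Bʲ(y)} |F x|²_τ ≤ η⁻²·Σ_μ Σ_{x, x+e_μ ∈ Bʲ(y)} |F x − F(x+e_μ)|²_τ + a_j·|(Q′_j(1) F)(y)|²_τ`).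
* §2 ★★★ `formPer_deltaPrimeAPer_one_coercive` (THE FLAT UNIFORM COERCIVITY ON THE TORUS: `η > 0`, `η·Lᵐ ≤ 1`, `a ≥ 0`, `a₀ ≤ 8`, `a₀·(Lᵐ)^d ≤ a_m·η²·(Lᵐ)²`,
  `Lᵐ ∣ P`, every top-level cell site a constraint site (`[0,P∕Lᵐ)ᵈ ⊆ Λ_m`), tracial Hermitian faithful `τ` ⟹ for every `f ∈ L²(T_P, ·)`:
  `a₀·⟨f, f⟩_{T_P} ≤ ⟨f, Δ′_a(1) f⟩_{T_P}` — a constant depending on `a₀` ONLY).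
* §3 ★★ `formPer_deltaPrimeAPer_one_coercive_torusLam` (the torus members' constraint sets `torusLam m`: the coverage hypothesis is void),
  `regularPrimePer_one_of_coercive` (`a₀ > 0` ⟹ the scalar regime at `U₀ = 1`, quantitative road).

HONEST SCOPE.  (i) The flat background only; the constant is explicit and member-uniform but NO statement at a curved `U₀` (the near-flat transfer by form comparison
is the Dirichlet lineage's `B9Eq324NearFlatFormComparisonZd*` — not ported here); no decay estimate (Thm 3.1's (3.42) NOT proved).  (ii) Only the TOP level's
averaging term is used (lower levels are dropped as non-negative), which is print's situation on the torus members (`Λ_j = ∅` for `j < m`).  (iii) Count-neutral;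
N05 ∕ N06 NOT discharged; K1⁹ `stmt-QuantumFields-27364` NOT closed; one finite `𝕋⁴` programme at fixed `ε`, Bałaban as printed; R4 closes only the conditional
finite-`𝕋⁴` rung `BalabanLadder.UV` — nothing continuum ∕ ℝ⁴ ∕ OS ∕ mass gap ∕ Clay.  Unit `pub-ymgap-dag-n06-w4` (g6), 2026-08-28.
-/

noncomputable section

namespace Literature.MathematicalPhysics.QuantumFieldTheory.Balaban1983to89.B9Thm31FlatPoincareCoerciveZdPer

open B7Prop1Explicit
open B7Eq78Linearization (QprimeIter zdBlocking)
open B7Prop2Explicit (unitaryUnits)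
open B8Ineq132 (covDerivFwd)
open B8Eq119TwistedAxial (bgT bgT_one)
open Literature.MathematicalPhysics.QuantumLattice (blockMap blockSites mem_blockSites_iff)
open T4TermwiseTorus (IsPeriodic box)
open B9Eq321LandauProjectionZdPer (perSub formPer formPer_apply)
open B9Eq321LandauOrthogonalZdPer (box_mul_eq_biUnion_blockSites pairwiseDisjoint_blockSites)
open B9Eq321LandauMultiplierIffZdPer (eq_pow_mul_div_of_dvd)
open B9Eq324DeltaPrimeAZdPer (deltaPrimeAPer formPer_deltaPrimeAPer RegularPrimePer bijective_of_form_pos)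
open B9Eq342CombesThomasFormZd (fnorm fnorm_sq fnorm_smul fnorm_nonneg)
open B9Thm31FlatPoincareCoerciveZd (block227_zd_fnorm fnorm_covDerivFwd_one_sq)

-- `Site` alone could resolve to the torus sites of `Setup.lean`; re-export the `ℤ^d` sites of `B7Prop1Explicit`.
export B7Prop1Explicit (Site)

variable {d : ℕ} {𝔸 : Type*} [CStarAlgebra 𝔸] [FiniteDimensional ℝ 𝔸]
variable (τ : 𝔸 →ₗ[ℂ] ℂ) (hτp : ∀ a : 𝔸, a ≠ 0 → 0 < (τ (star a * a)).re) (hτs : ∀ a : 𝔸, τ (star a) = starRingEnd ℂ (τ a))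

/-! ## §1  One block, any site function: `a₀·Σ_{Bʲ(y)} |F|²_τ ≤ η⁻²·Σ_{internal bonds} |δF|²_τ + a_j·|(Q′_j(1)F)(y)|²_τ` -/

section OneBlock

variable {L : ℕ} [NeZero L] {η : ℝ}

include hτp hτs in
/-- ★ **THE WEIGHTED BLOCK INEQUALITY AT THE FLAT BACKGROUND, FOR ANY SITE FUNCTION** ([Balaban1984PropagatorsII] (2.26)–(2.27) × `(Lʲη)⁻²`): for a level `j` with
`η·Lʲ ≤ 1`, a weight `a_j ≥ 0` and any `a₀ ≤ 8` with `a₀·(Lʲ)^d ≤ a_j·η²·(Lʲ)²` (print's `a_j = a·η⁻²L^{(d−2)j}` gives `a₀ = min{8, a}`), every `F : ℤᵈ → 𝔸` satisfies on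
the block `Bʲ(y)`: `a₀·Σ_{x∈Bʲ(y)} |F x|²_τ ≤ η⁻²·Σ_μ Σ_{x, x+e_μ ∈ Bʲ(y)} |F x − F(x+e_μ)|²_τ + a_j·|(Q′_j(1) F)(y)|²_τ` — g5's `block_coercive_one` without the support
wrapper (the flat average `Q′_j(1)F(y)` is the block mean, `B7Eq214FlatQprime.QprimeIter_one_eq_sum_blockSites`).
[cite: Balaban1984PropagatorsII, (2.26)–(2.27) p.235; Balaban1983RegularityDecay, (2.27) p.580; Balaban1985BackgroundPropagators, (3.23)–(3.24) p.394] -/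
theorem block_coercive_one_fun (hη : 0 < η) {j : ℕ} (hηL : η * (L : ℝ) ^ j ≤ 1) {aj a₀ : ℝ} (haj : 0 ≤ aj) (ha₀8 : a₀ ≤ 8)
    (ha₀ : a₀ * ((L : ℝ) ^ j) ^ d ≤ aj * η ^ 2 * ((L : ℝ) ^ j) ^ 2) (y : Site d) (F : Site d → 𝔸) :
    a₀ * ∑ x ∈ blockSites (L ^ j) y, fnorm τ (F x) ^ 2
      ≤ (η ^ 2)⁻¹ * ∑ μ : Fin d, ∑ x ∈ (blockSites (L ^ j) y).filter (fun x => x + e μ ∈ blockSites (L ^ j) y),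
            fnorm τ (F x - F (x + e μ)) ^ 2
        + aj * fnorm τ (QprimeIter (zdBlocking d L) (bgT L (1 : Site d → Fin d → 𝔸ˣ)) j F y) ^ 2 := by
  classical
  have hL1 : 1 ≤ L := Nat.pos_of_ne_zero (NeZero.ne L)
  have hL0 : (0 : ℝ) < (L : ℝ) := by exact_mod_cast hL1
  set N : ℝ := (L : ℝ) ^ j with hNdef
  have hN : 0 < N := by positivity
  set D : ℝ := N ^ d with hDdef
  have hD : 0 < D := by positivity
  have hη2 : 0 < η ^ 2 := by positivity
  -- the block as `{x : blockMap (n+1) x = y}` with `n + 1 = Lʲ`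
  have hNsucc : L ^ j - 1 + 1 = L ^ j := Nat.sub_add_cancel (Nat.one_le_pow _ _ hL1)
  haveI : NeZero (L ^ j) := ⟨pow_ne_zero j (NeZero.ne L)⟩
  have hB : ∀ x : Site d, x ∈ blockSites (L ^ j) y ↔ blockMap (L ^ j - 1 + 1) x = y := by
    intro x
    rw [hNsucc]
    exact mem_blockSites_iff (L ^ j) y x
  have hcast : ((L ^ j - 1 : ℕ) : ℝ) + 1 = N := by
    have h1 : ((L ^ j - 1 : ℕ) : ℝ) + 1 = ((L ^ j - 1 + 1 : ℕ) : ℝ) := by push_cast; ring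
    rw [h1, hNsucc]
    push_cast
    rfl
  -- the scaled weight
  set a' : ℝ := aj * η ^ 2 * N ^ 2 * D⁻¹ with ha'def
  have ha'0 : 0 ≤ a' := by positivity
  have h227 := block227_zd_fnorm τ hτp hτs (L ^ j - 1) y (blockSites (L ^ j) y) hB a' F
  rw [hcast] at h227
  -- abbreviations
  set S0 := ∑ x ∈ blockSites (L ^ j) y, fnorm τ (F x) ^ 2 with hS0
  set S1 := ∑ μ : Fin d, ∑ x ∈ (blockSites (L ^ j) y).filter (fun x => x + e μ ∈ blockSites (L ^ j) y),
    fnorm τ (F x - F (x + e μ)) ^ 2 with hS1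
  set S2 := fnorm τ (∑ x ∈ blockSites (L ^ j) y, F x) ^ 2 with hS2
  have hS0nn : 0 ≤ S0 := Finset.sum_nonneg fun _ _ => sq_nonneg _
  -- the averaging term: `|Q′_j(1) F (y)|² = D⁻² · S2`
  have hQ : fnorm τ (QprimeIter (zdBlocking d L) (bgT L (1 : Site d → Fin d → 𝔸ˣ)) j F y) ^ 2 = (D⁻¹) ^ 2 * S2 := by
    rw [bgT_one, B7Eq214FlatQprime.QprimeIter_one_eq_sum_blockSites hL1 F j y, ← Finset.smul_sum, fnorm_smul, mul_pow, sq_abs, hS2, hDdef, hNdef,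
      ← pow_mul]
  -- scale (2.27) by `c = (η²N²)⁻¹ ≥ 1`
  set c : ℝ := (η ^ 2)⁻¹ * (N ^ 2)⁻¹ with hcdef
  have hc0 : 0 < c := by positivity
  have hc1 : 1 ≤ c := by
    rw [hcdef, ← mul_inv, one_le_inv_iff₀]
    refine ⟨by positivity, ?_⟩
    calc η ^ 2 * N ^ 2 = (η * N) ^ 2 := by ring
      _ ≤ 1 := by
        have h0 : 0 ≤ η * N := by positivity
        nlinarith [h0, hηL]
  have hscaled : min 8 a' * c * S0 ≤ (η ^ 2)⁻¹ * S1 + aj * ((D⁻¹) ^ 2 * S2) := by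
    have h := mul_le_mul_of_nonneg_left h227 hc0.le
    have e1 : c * (min 8 a' * S0) = min 8 a' * c * S0 := by ring
    have e2 : c * (N ^ 2 * S1 + a' * D⁻¹ * S2) = (η ^ 2)⁻¹ * S1 + aj * ((D⁻¹) ^ 2 * S2) := by
      rw [hcdef, ha'def]
      field_simp
    rw [e1, e2] at h
    exact h
  -- `a₀ ≤ min 8 a' ≤ min 8 a' · c`
  have ha₀a' : a₀ ≤ a' := by
    rw [ha'def, hDdef, hNdef]
    rw [le_mul_inv_iff₀ hD]
    exact ha₀
  have hmin : a₀ ≤ min 8 a' * c := by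
    have h1 : a₀ ≤ min 8 a' := le_min ha₀8 ha₀a'
    have h2 : 0 ≤ min 8 a' := le_min (by norm_num) ha'0
    calc a₀ ≤ min 8 a' := h1
      _ = min 8 a' * 1 := (mul_one _).symm
      _ ≤ min 8 a' * c := mul_le_mul_of_nonneg_left hc1 h2
  calc a₀ * S0 ≤ min 8 a' * c * S0 := mul_le_mul_of_nonneg_right hmin hS0nn
    _ ≤ (η ^ 2)⁻¹ * S1 + aj * ((D⁻¹) ^ 2 * S2) := hscaled
    _ = (η ^ 2)⁻¹ * S1 + aj * fnorm τ (QprimeIter (zdBlocking d L) (bgT L (1 : Site d → Fin d → 𝔸ˣ)) j F y) ^ 2 := by rw [hQ]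

end OneBlock

/-! ## §2  The torus assembly: the top-level blocks tile the period cell -/

section Torus

variable {P L : ℕ} [NeZero P] [NeZero L] {η : ℝ} {m : ℕ} {a : ℕ → ℝ} {Λs : ℕ → Set (Site d)}

include hτp hτs in
/-- ★★★ **THE FLAT UNIFORM COERCIVITY OF `Δ′_a(1)` ON THE TORUS** ([Balaban1984PropagatorsII] (2.22) ∕ [Balaban1985BackgroundPropagators] Thm 3.1's positivity at
`U₀ = 1`, member-uniform constant): `η > 0`, `η·Lᵐ ≤ 1`, weights `a ≥ 0` with `a₀·(Lᵐ)^d ≤ a_m·η²·(Lᵐ)²` for some `a₀ ≤ 8` (print's `a_m = a·η⁻²L^{(d−2)m}`: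
`a₀ = min{8, a}`), `Lᵐ ∣ P`, EVERY top-level cell site a constraint site (`[0,P∕Lᵐ)ᵈ ⊆ Λ_m` — the torus members), tracial Hermitian faithful `τ`.  Then for every
`f ∈ L²(T_P, ·)`: `a₀·⟨f, f⟩_{T_P} ≤ ⟨f, Δ′_a(1) f⟩_{T_P}` — the constant depends on `a₀` ONLY (not on `η`, `m`, `P`).  Proof: the top-level blocks `Bᵐ(y)`,
`y ∈ [0,P∕Lᵐ)ᵈ`, tile the cell; §1 on each; the internal bonds are bonds of the cell and the lower levels' averaging terms are non-negative.
[cite: Balaban1984PropagatorsII, (2.22) p.226, (2.26)–(2.27) p.235; Balaban1985BackgroundPropagators, Thm 3.1 p.397, (3.23)–(3.24) p.394, Thm 3.11 p.416; Balaban1985RegularSpaces, p.77 («Ω_j = T_η»)] -/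
theorem formPer_deltaPrimeAPer_one_coercive (hη : 0 < η) (hηL : η * (L : ℝ) ^ m ≤ 1) (ha : ∀ j, 0 ≤ a j) {a₀ : ℝ} (ha₀8 : a₀ ≤ 8)
    (ha₀ : a₀ * ((L : ℝ) ^ m) ^ d ≤ a m * η ^ 2 * ((L : ℝ) ^ m) ^ 2) (hP : L ^ m ∣ P) (hΛm : ∀ y ∈ box (d := d) (P / L ^ m), y ∈ Λs m)
    (hτt : ∀ a b : 𝔸, τ (a * b) = τ (b * a)) (f : perSub (𝔸 := 𝔸) (d := d) P) :
    a₀ * formPer τ P f f ≤ formPer τ P f (deltaPrimeAPer L (1 : Site d → Fin d → 𝔸ˣ) η m a Λs P f) := by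
  classical
  set F : Site d → 𝔸 := (f : Site d → 𝔸) with hF
  set Q : ℕ := P / L ^ m with hQdef
  have hPQ : P = L ^ m * Q := eq_pow_mul_div_of_dvd hP le_rfl
  haveI : NeZero (L ^ m) := ⟨pow_ne_zero m (NeZero.ne L)⟩
  have hU1 : ∀ (x : Site d) (κ : Fin d), (1 : Site d → Fin d → 𝔸ˣ) x κ ∈ unitaryUnits 𝔸 := fun _ _ => (unitaryUnits 𝔸).one_mem
  have hT1 : ∀ (j : ℕ) (z y : Site d), bgT L (1 : Site d → Fin d → 𝔸ˣ) j z y ∈ unitaryUnits 𝔸 := fun j z y => by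
    rw [bgT_one]; exact (unitaryUnits 𝔸).one_mem
  have hUper : IsPeriodic P (1 : Site d → Fin d → 𝔸ˣ) := fun _ _ => rfl
  -- the cell IS the disjoint union of the top-level blocks
  have hcell : box (d := d) P = (box (d := d) Q).biUnion (blockSites (L ^ m)) := by
    rw [hPQ]
    exact box_mul_eq_biUnion_blockSites (L ^ m) Q
  have hdisj := pairwiseDisjoint_blockSites (d := d) (L ^ m) (↑(box (d := d) Q) : Set (Site d))
  -- (i) the left side, block by block
  have hL : a₀ * formPer τ P f f = ∑ y ∈ box (d := d) Q, a₀ * ∑ x ∈ blockSites (L ^ m) y, fnorm τ (F x) ^ 2 := by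
    rw [formPer_apply, hcell, Finset.sum_biUnion hdisj, Finset.mul_sum]
    refine Finset.sum_congr rfl fun y _ => ?_
    congr 1
    exact Finset.sum_congr rfl fun x _ => (fnorm_sq hτp _).symm
  -- (ii) the per-block inequality
  have hblock : ∀ y ∈ box (d := d) Q, a₀ * ∑ x ∈ blockSites (L ^ m) y, fnorm τ (F x) ^ 2 ≤
      (η ^ 2)⁻¹ * ∑ μ : Fin d, ∑ x ∈ (blockSites (L ^ m) y).filter (fun x => x + e μ ∈ blockSites (L ^ m) y), fnorm τ (F x - F (x + e μ)) ^ 2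
        + a m * fnorm τ (QprimeIter (zdBlocking d L) (bgT L (1 : Site d → Fin d → 𝔸ˣ)) m F y) ^ 2 :=
    fun y _ => block_coercive_one_fun τ hτp hτs hη hηL (ha m) ha₀8 ha₀ y F
  -- (iii) the right side
  rw [formPer_deltaPrimeAPer τ hτt hU1 hT1 hUper hP f f]
  -- (iv) the gradient energy of the cell dominates the internal-bond sums of all top-level blocks
  have hgrad : ∀ μ : Fin d,
      (η ^ 2)⁻¹ * ∑ y ∈ box (d := d) Q, ∑ x ∈ (blockSites (L ^ m) y).filter (fun x => x + e μ ∈ blockSites (L ^ m) y), fnorm τ (F x - F (x + e μ)) ^ 2 ≤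
        ∑ x ∈ box (d := d) P, (τ (star (covDerivFwd η (1 : Site d → Fin d → 𝔸ˣ) μ F x) * covDerivFwd η (1 : Site d → Fin d → 𝔸ˣ) μ F x)).re := by
    intro μ
    have hdisjμ : (↑(box (d := d) Q) : Set (Site d)).PairwiseDisjoint
        (fun y => (blockSites (L ^ m) y).filter (fun x => x + e μ ∈ blockSites (L ^ m) y)) := by
      intro p hp q hq hne
      exact Finset.disjoint_filter_filter (hdisj hp hq hne)
    rw [Finset.mul_sum]
    have hsub : (box (d := d) Q).biUnion (fun y => (blockSites (L ^ m) y).filter (fun x => x + e μ ∈ blockSites (L ^ m) y)) ⊆ box (d := d) P := by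
      intro x hx
      rw [Finset.mem_biUnion] at hx
      obtain ⟨y, hy, hxy⟩ := hx
      rw [Finset.mem_filter] at hxy
      rw [hcell, Finset.mem_biUnion]
      exact ⟨y, hy, hxy.1⟩
    calc ∑ y ∈ box (d := d) Q, (η ^ 2)⁻¹ * ∑ x ∈ (blockSites (L ^ m) y).filter (fun x => x + e μ ∈ blockSites (L ^ m) y), fnorm τ (F x - F (x + e μ)) ^ 2
        = ∑ y ∈ box (d := d) Q, ∑ x ∈ (blockSites (L ^ m) y).filter (fun x => x + e μ ∈ blockSites (L ^ m) y),
            fnorm τ (covDerivFwd η (1 : Site d → Fin d → 𝔸ˣ) μ F x) ^ 2 := by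
          refine Finset.sum_congr rfl fun y _ => ?_
          rw [Finset.mul_sum]
          exact Finset.sum_congr rfl fun x _ => (fnorm_covDerivFwd_one_sq τ η μ F x).symm
      _ = ∑ x ∈ (box (d := d) Q).biUnion (fun y => (blockSites (L ^ m) y).filter (fun x => x + e μ ∈ blockSites (L ^ m) y)),
            fnorm τ (covDerivFwd η (1 : Site d → Fin d → 𝔸ˣ) μ F x) ^ 2 := (Finset.sum_biUnion hdisjμ).symm
      _ ≤ ∑ x ∈ box (d := d) P, fnorm τ (covDerivFwd η (1 : Site d → Fin d → 𝔸ˣ) μ F x) ^ 2 :=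
          Finset.sum_le_sum_of_subset_of_nonneg hsub fun _ _ _ => sq_nonneg _
      _ = _ := Finset.sum_congr rfl fun x _ => fnorm_sq hτp _
  -- (v) the top-level averaging term is one of the (non-negative) level terms
  have hterm_nn : ∀ (j : ℕ) (y : Site d), 0 ≤ (Λs j).indicator (fun y => a j *
      (τ (star (QprimeIter (zdBlocking d L) (bgT L (1 : Site d → Fin d → 𝔸ˣ)) j F y) *
        QprimeIter (zdBlocking d L) (bgT L (1 : Site d → Fin d → 𝔸ˣ)) j F y)).re) y := by
    intro j y
    by_cases hy : y ∈ Λs j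
    · rw [Set.indicator_of_mem hy, ← fnorm_sq hτp]
      exact mul_nonneg (ha j) (sq_nonneg _)
    · rw [Set.indicator_of_notMem hy]
  have havg : ∑ y ∈ box (d := d) Q, a m * fnorm τ (QprimeIter (zdBlocking d L) (bgT L (1 : Site d → Fin d → 𝔸ˣ)) m F y) ^ 2 ≤
      ∑ j ∈ Finset.range (m + 1), ∑ y ∈ box (d := d) (P / L ^ j),
        (Λs j).indicator (fun y => a j * (τ (star (QprimeIter (zdBlocking d L) (bgT L (1 : Site d → Fin d → 𝔸ˣ)) j F y) *
          QprimeIter (zdBlocking d L) (bgT L (1 : Site d → Fin d → 𝔸ˣ)) j F y)).re) y := by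
    have hm : m ∈ Finset.range (m + 1) := Finset.mem_range.2 (Nat.lt_succ_self m)
    refine le_trans (le_of_eq ?_) (Finset.single_le_sum (fun j _ => Finset.sum_nonneg fun y _ => hterm_nn j y) hm)
    rw [← hQdef]
    refine Finset.sum_congr rfl fun y hy => ?_
    rw [Set.indicator_of_mem (hΛm y hy), ← fnorm_sq hτp]
  -- (vi) assemble
  rw [hL]
  calc ∑ y ∈ box (d := d) Q, a₀ * ∑ x ∈ blockSites (L ^ m) y, fnorm τ (F x) ^ 2
      ≤ ∑ y ∈ box (d := d) Q, ((η ^ 2)⁻¹ * ∑ μ : Fin d, ∑ x ∈ (blockSites (L ^ m) y).filter (fun x => x + e μ ∈ blockSites (L ^ m) y),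
            fnorm τ (F x - F (x + e μ)) ^ 2
          + a m * fnorm τ (QprimeIter (zdBlocking d L) (bgT L (1 : Site d → Fin d → 𝔸ˣ)) m F y) ^ 2) := Finset.sum_le_sum hblock
    _ = (∑ μ : Fin d, (η ^ 2)⁻¹ * ∑ y ∈ box (d := d) Q, ∑ x ∈ (blockSites (L ^ m) y).filter (fun x => x + e μ ∈ blockSites (L ^ m) y),
            fnorm τ (F x - F (x + e μ)) ^ 2) +
          ∑ y ∈ box (d := d) Q, a m * fnorm τ (QprimeIter (zdBlocking d L) (bgT L (1 : Site d → Fin d → 𝔸ˣ)) m F y) ^ 2 := by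
        rw [Finset.sum_add_distrib]
        congr 1
        rw [← Finset.mul_sum, ← Finset.mul_sum, Finset.sum_comm]
    _ ≤ _ := add_le_add (Finset.sum_le_sum fun μ _ => hgrad μ) havg

omit [NeZero L] in
include hτp in
/-- **COERCIVITY ⟹ THE SCALAR REGIME AT THE FLAT BACKGROUND, QUANTITATIVELY**: with `0 < a₀` the form is positive definite, hence `Δ′_a(1)` is invertible on
`L²(T_P, ·)` (`RegularPrimePer`). [cite: Balaban1985BackgroundPropagators, Thm 3.11 p.416, (3.24) p.394] -/
theorem regularPrimePer_one_of_coercive {a₀ : ℝ} (ha₀ : 0 < a₀)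
    (hco : ∀ f : perSub (𝔸 := 𝔸) (d := d) P, a₀ * formPer τ P f f ≤ formPer τ P f (deltaPrimeAPer L (1 : Site d → Fin d → 𝔸ˣ) η m a Λs P f)) :
    RegularPrimePer L (1 : Site d → Fin d → 𝔸ˣ) η m a Λs P := by
  refine bijective_of_form_pos τ fun f hf => lt_of_lt_of_le ?_ (hco f)
  have hnn : 0 ≤ formPer τ P f f := by
    rw [formPer_apply]
    exact Finset.sum_nonneg fun x _ => by rw [← fnorm_sq hτp]; exact sq_nonneg _
  have hpos : 0 < formPer τ P f f := by
    rcases hnn.lt_or_eq with h | h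
    · exact h
    · exact absurd (B9Eq321LandauProjectionZdPer.formPer_apply_self_eq_zero τ P hτp h.symm) hf
  exact mul_pos ha₀ hpos

end Torus

/-! ## §3  The torus members' constraint sets -/

section TorusLam

open B8Thm4TorusAt (torusLam torusLam_self)

variable {P L : ℕ} [NeZero P] [NeZero L] {η : ℝ} {m : ℕ} {a : ℕ → ℝ}

include hτp hτs in
/-- ★★ **THE FLAT UNIFORM COERCIVITY AT THE TORUS MEMBERS** (constraint sets `torusLam m`: none below the top level, every top-level site): the coverage hypothesis of
§2 is void, so `a₀·⟨f, f⟩_{T_P} ≤ ⟨f, Δ′_a(1) f⟩_{T_P}` for every `f ∈ L²(T_P, ·)` under `η > 0`, `η·Lᵐ ≤ 1`, `a ≥ 0`, `a₀ ≤ 8`, `a₀·(Lᵐ)^d ≤ a_m·η²·(Lᵐ)²`, `Lᵐ ∣ P`.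
[cite: Balaban1984PropagatorsII, (2.22) p.226; Balaban1985BackgroundPropagators, Thm 3.1 p.397, Thm 3.11 p.416; Balaban1985RegularSpaces, (1.28) p.81, p.77 («Ω_j = T_η»)] -/
theorem formPer_deltaPrimeAPer_one_coercive_torusLam (hη : 0 < η) (hηL : η * (L : ℝ) ^ m ≤ 1) (ha : ∀ j, 0 ≤ a j) {a₀ : ℝ} (ha₀8 : a₀ ≤ 8)
    (ha₀ : a₀ * ((L : ℝ) ^ m) ^ d ≤ a m * η ^ 2 * ((L : ℝ) ^ m) ^ 2) (hP : L ^ m ∣ P) (hτt : ∀ a b : 𝔸, τ (a * b) = τ (b * a))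
    (f : perSub (𝔸 := 𝔸) (d := d) P) :
    a₀ * formPer τ P f f ≤ formPer τ P f (deltaPrimeAPer L (1 : Site d → Fin d → 𝔸ˣ) η m a (torusLam (d := d) m) P f) :=
  formPer_deltaPrimeAPer_one_coercive τ hτp hτs hη hηL ha ha₀8 ha₀ hP (fun y _ => by rw [torusLam_self]; exact Set.mem_univ y) hτt f

end TorusLam

end Literature.MathematicalPhysics.QuantumFieldTheory.Balaban1983to89.B9Thm31FlatPoincareCoerciveZdPer

end
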